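import Literature.Analysis.Calculus.AreaFormulaHausdorff
import Literature.Geometry.Lorentzian.Basic
import Mathlib.Analysis.SpecialFunctions.PolarCoord
import Mathlib.Analysis.SpecialFunctions.Trigonometric.Inverse
import Mathlib.Analysis.Normed.Lp.Matrix

/-!
# Route EIHFluxBalance — `LLBalanceLaw` (v): spherical coordinates on round spheres of `E3`

Helper file for the support item `stmt-FinalStateConjecture-10189`
(`Summit.FinalStateConjecture.FinalStateConjecture.Theses.EIHFluxBalance.LLBalanceLaw`), clause (v)
(the spherical shell formula `∫_R^{2R} ∮_{S_ρ} f dμHE[2] dρ = ∫_{R<|y|<2R} f`). This file is the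
SURFACE half: the spherical parametrisation of the round sphere of radius `ρ` in `E3`,
`σ_ρ(θ, φ) = ρ (sin θ cos φ, sin θ sin φ, cos θ)` on the box `(0, π) × (−π, π)` (a subset of
`EuclideanSpace ℝ (Fin 2)`, so that the tree's area formula for the Euclidean Hausdorff measure
`μHE[2]` applies), with

* its derivative `ρ • J(θ, φ)`, `J` the `3 × 2` Jacobian of the unit map (`hasFDerivAt_sphUnit`,
  `hasFDerivAt_sphMap`), injective for `sin θ ≠ 0`;
* its `2`-Jacobian `normDet (ρ • J) = ρ² sin θ` (Gram determinant `sin² θ` of the two columns;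
  `normDet_sphMap`);
* injectivity on the box (through Mathlib's `polarCoord` for the azimuth and `injOn_cos` for the
  polar angle) and the image: the sphere `{‖y‖ = ρ}` minus the closed half great circle
  `{y₁ = 0, y₀ ≤ 0}` (`sphMap_mem_sphere`, `image_sphMap_box`);
* the area formula on the sphere (`setIntegral_image_sphMap`, `setIntegral_sphere_eq_…`):
  `∮_{|y|=ρ} f dμHE[2] = ∫_{box} ρ² sin θ · f(σ_ρ(θ, φ)) d(θ, φ)` (tree's area formula, Federer 3.2.5).
No definitions: the maps are explicit lambdas behind local notations.
-/

noncomputable section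

open MeasureTheory MeasureTheory.Measure Set Function Filter Metric Module Real
open scoped Topology ENNReal

namespace Summit.FinalStateConjecture.FinalStateConjecture.Theorems

namespace LLSphere

open Literature.Geometry.Lorentzian

/-- The parameter plane `ℝ²` of spherical coordinates `(θ, φ) = (p 0, p 1)`. -/
local notation "E2" => EuclideanSpace ℝ (Fin 2)

/-- The unit spherical map `(θ, φ) ↦ (sin θ cos φ, sin θ sin φ, cos θ)`. -/
local notation "sphUnit" => (fun p : EuclideanSpace ℝ (Fin 2) ↦
  (WithLp.toLp 2 ![sin (p 0) * cos (p 1), sin (p 0) * sin (p 1), cos (p 0)] : E3))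

/-- The Jacobian matrix of `sphUnit` at `(θ, φ)` (rows = components, columns = `∂_θ, ∂_φ`). -/
local notation "sphJac" => (fun p : EuclideanSpace ℝ (Fin 2) ↦
  (!![cos (p 0) * cos (p 1), -(sin (p 0) * sin (p 1));
      cos (p 0) * sin (p 1), sin (p 0) * cos (p 1);
      -sin (p 0), 0] : Matrix (Fin 3) (Fin 2) ℝ))

/-- The Jacobian of `sphUnit` at `p` as a continuous linear map `ℝ² →L ℝ³`. -/
local notation "sphJacCLM" => (fun p : EuclideanSpace ℝ (Fin 2) ↦
  LinearMap.toContinuousLinearMap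
    (Matrix.toLpLin 2 2 (sphJac p) : EuclideanSpace ℝ (Fin 2) →ₗ[ℝ] E3))

/-- The parameter box `(0, π) × (−π, π)`. -/
local notation "sphBox" =>
  (setOf fun p : EuclideanSpace ℝ (Fin 2) ↦ p 0 ∈ Ioo 0 π ∧ p 1 ∈ Ioo (-π) π)

/-! ### The Jacobian as a linear map: coordinates -/

/-- Coordinates of the Jacobian applied to a vector: `(J(p) v)_i = Σ_j J_{ij} v_j`. [folklore] -/
theorem sphJacCLM_apply (p v : E2) (i : Fin 3) :
    (sphJacCLM p v) i = (sphJac p) i 0 * v 0 + (sphJac p) i 1 * v 1 := by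
  fin_cases i <;> simp [Matrix.toLpLin_apply, dotProduct, Fin.sum_univ_two]

/-! ### Derivative of the spherical maps -/

/-- The unit spherical map in the standard basis `e_i = EuclideanSpace.single i 1`. [folklore] -/
theorem sphUnit_eq_sum (q : E2) :
    sphUnit q = (sin (q 0) * cos (q 1)) • EuclideanSpace.single (0 : Fin 3) (1 : ℝ) +
      (sin (q 0) * sin (q 1)) • EuclideanSpace.single (1 : Fin 3) (1 : ℝ) +
        cos (q 0) • EuclideanSpace.single (2 : Fin 3) (1 : ℝ) := by
  ext i
  fin_cases i <;> simp

/-- **The unit spherical map is differentiable with derivative the Jacobian matrix.**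
[folklore] -/
theorem hasFDerivAt_sphUnit (p : E2) : HasFDerivAt sphUnit (sphJacCLM p) p := by
  have h0 : HasFDerivAt (fun q : E2 ↦ (q 0 : ℝ))
      (EuclideanSpace.proj (𝕜 := ℝ) (0 : Fin 2) : E2 →L[ℝ] ℝ) p :=
    (EuclideanSpace.proj (𝕜 := ℝ) (0 : Fin 2)).hasFDerivAt
  have h1 : HasFDerivAt (fun q : E2 ↦ (q 1 : ℝ))
      (EuclideanSpace.proj (𝕜 := ℝ) (1 : Fin 2) : E2 →L[ℝ] ℝ) p :=
    (EuclideanSpace.proj (𝕜 := ℝ) (1 : Fin 2)).hasFDerivAt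
  have hs0 : HasFDerivAt (fun q : E2 ↦ sin (q 0))
      (cos (p 0) • (EuclideanSpace.proj (𝕜 := ℝ) (0 : Fin 2) : E2 →L[ℝ] ℝ)) p := by
    simpa [Function.comp_def] using (Real.hasDerivAt_sin (p 0)).comp_hasFDerivAt p h0
  have hc0 : HasFDerivAt (fun q : E2 ↦ cos (q 0))
      (-sin (p 0) • (EuclideanSpace.proj (𝕜 := ℝ) (0 : Fin 2) : E2 →L[ℝ] ℝ)) p := by
    simpa [Function.comp_def] using (Real.hasDerivAt_cos (p 0)).comp_hasFDerivAt p h0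
  have hs1 : HasFDerivAt (fun q : E2 ↦ sin (q 1))
      (cos (p 1) • (EuclideanSpace.proj (𝕜 := ℝ) (1 : Fin 2) : E2 →L[ℝ] ℝ)) p := by
    simpa [Function.comp_def] using (Real.hasDerivAt_sin (p 1)).comp_hasFDerivAt p h1
  have hc1 : HasFDerivAt (fun q : E2 ↦ cos (q 1))
      (-sin (p 1) • (EuclideanSpace.proj (𝕜 := ℝ) (1 : Fin 2) : E2 →L[ℝ] ℝ)) p := by
    simpa [Function.comp_def] using (Real.hasDerivAt_cos (p 1)).comp_hasFDerivAt p h1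
  have h := (((hs0.mul hc1).smul_const (EuclideanSpace.single (0 : Fin 3) (1 : ℝ))).add
    ((hs0.mul hs1).smul_const (EuclideanSpace.single (1 : Fin 3) (1 : ℝ)))).add
    (hc0.smul_const (EuclideanSpace.single (2 : Fin 3) (1 : ℝ)))
  have hfun : sphUnit = fun q : E2 ↦ (sin (q 0) * cos (q 1)) • EuclideanSpace.single (0 : Fin 3) (1 : ℝ) +
      (sin (q 0) * sin (q 1)) • EuclideanSpace.single (1 : Fin 3) (1 : ℝ) +
        cos (q 0) • EuclideanSpace.single (2 : Fin 3) (1 : ℝ) := funext sphUnit_eq_sum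
  rw [hfun]
  refine h.congr_fderiv ?_
  ext v i
  rw [sphJacCLM_apply]
  fin_cases i <;> simp <;> ring

/-- **The spherical map of radius `ρ`, `σ_ρ = ρ • sphUnit`, has derivative `ρ • J`.** [folklore] -/
theorem hasFDerivAt_sphMap (ρ : ℝ) (p : E2) :
    HasFDerivAt (fun q : E2 ↦ ρ • sphUnit q) (ρ • sphJacCLM p) p :=
  (hasFDerivAt_sphUnit p).const_smul ρ

/-! ### The `2`-Jacobian `normDet (ρ • J) = ρ² sin θ` -/

/-- First column of the Jacobian, `∂_θ`. [folklore] -/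
theorem sphJacCLM_basisFun_zero (p : E2) :
    sphJacCLM p (EuclideanSpace.basisFun (Fin 2) ℝ 0) =
      WithLp.toLp 2 ![cos (p 0) * cos (p 1), cos (p 0) * sin (p 1), -sin (p 0)] := by
  ext i
  rw [sphJacCLM_apply]
  fin_cases i <;> simp

/-- Second column of the Jacobian, `∂_φ`. [folklore] -/
theorem sphJacCLM_basisFun_one (p : E2) :
    sphJacCLM p (EuclideanSpace.basisFun (Fin 2) ℝ 1) =
      WithLp.toLp 2 ![-(sin (p 0) * sin (p 1)), sin (p 0) * cos (p 1), 0] := by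
  ext i
  rw [sphJacCLM_apply]
  fin_cases i <;> simp

/-- The Gram determinant of the two columns is `sin² θ`. [folklore] -/
theorem det_gram_sphJacCLM (p : E2) :
    (Matrix.gram ℝ fun j ↦ ((sphJacCLM p : E2 →L[ℝ] E3) : E2 →ₗ[ℝ] E3)
      (EuclideanSpace.basisFun (Fin 2) ℝ j)).det = sin (p 0) ^ 2 := by
  rw [Matrix.det_fin_two]
  simp only [Matrix.gram, Matrix.of_apply, ContinuousLinearMap.coe_coe,
    sphJacCLM_basisFun_zero, sphJacCLM_basisFun_one, PiLp.inner_apply, PiLp.toLp_apply,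
    Fin.sum_univ_three, Matrix.cons_val_zero, Matrix.cons_val_one, Matrix.cons_val_two,
    Matrix.head_cons, Matrix.tail_cons, RCLike.inner_apply, conj_trivial]
  linear_combination (sin (p 0) ^ 2 * (cos (p 0) ^ 2 * (sin (p 1) ^ 2 + cos (p 1) ^ 2 - 1) +
    cos (p 0) ^ 2 + (sin (p 0) ^ 2 + cos (p 0) ^ 2 - 1) + 1)) * Real.sin_sq_add_cos_sq (p 1) +
    sin (p 0) ^ 2 * Real.sin_sq_add_cos_sq (p 0)

/-- **The `2`-Jacobian of the unit spherical map is `sin θ`** (for `sin θ ≥ 0`). [folklore] -/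
theorem normDet_sphJacCLM (p : E2) (hp : 0 ≤ sin (p 0)) :
    (((sphJacCLM p : E2 →L[ℝ] E3) : E2 →ₗ[ℝ] E3)).normDet = sin (p 0) := by
  have hsq := LinearMap.normDet_sq_eq_det_gram
    ((sphJacCLM p : E2 →L[ℝ] E3) : E2 →ₗ[ℝ] E3) (EuclideanSpace.basisFun (Fin 2) ℝ)
  rw [det_gram_sphJacCLM] at hsq
  have hsq' : (((sphJacCLM p : E2 →L[ℝ] E3) : E2 →ₗ[ℝ] E3)).normDet ^ 2 = sin (p 0) ^ 2 := by
    exact_mod_cast hsq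
  have h0 := LinearMap.normDet_nonneg (((sphJacCLM p : E2 →L[ℝ] E3) : E2 →ₗ[ℝ] E3))
  nlinarith [hsq', h0, hp]

/-- **The `2`-Jacobian of `σ_ρ = ρ • sphUnit` is `ρ² sin θ`** (`ρ, sin θ ≥ 0`). [folklore] -/
theorem normDet_sphMap {ρ : ℝ} (hρ : 0 ≤ ρ) (p : E2) (hp : 0 ≤ sin (p 0)) :
    (((ρ • sphJacCLM p : E2 →L[ℝ] E3) : E2 →ₗ[ℝ] E3)).normDet = ρ ^ 2 * sin (p 0) := by
  rw [ContinuousLinearMap.toLinearMap_smul, LinearMap.normDet_smul, normDet_sphJacCLM p hp,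
    finrank_euclideanSpace_fin, Real.norm_of_nonneg hρ]

/-- The differential of `σ_ρ` is injective where `ρ sin θ ≠ 0`. [folklore] -/
theorem injective_sphJac_smul {ρ : ℝ} (hρ : 0 < ρ) (p : E2) (hp : 0 < sin (p 0)) :
    Injective (((ρ • sphJacCLM p : E2 →L[ℝ] E3) : E2 →ₗ[ℝ] E3)) := by
  have hne : (((ρ • sphJacCLM p : E2 →L[ℝ] E3) : E2 →ₗ[ℝ] E3)).normDet ≠ 0 := by
    rw [normDet_sphMap hρ.le p hp.le]
    positivity
  have hker : LinearMap.ker (((ρ • sphJacCLM p : E2 →L[ℝ] E3) : E2 →ₗ[ℝ] E3)) = ⊥ := by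
    by_contra h
    exact hne (LinearMap.normDet_eq_zero_iff_ker_ne_bot.mpr h)
  exact LinearMap.ker_eq_bot.mp hker

/-! ### The image lies on the sphere -/

/-- `‖sphUnit p‖ = 1`. [folklore] -/
theorem norm_sphUnit (p : E2) : ‖sphUnit p‖ = 1 := by
  rw [EuclideanSpace.norm_eq, Real.sqrt_eq_one]
  simp only [Fin.sum_univ_three, Matrix.cons_val_zero, Matrix.cons_val_one,
    Matrix.cons_val_two, Matrix.head_cons, Matrix.tail_cons, Real.norm_eq_abs, sq_abs]
  linear_combination sin (p 0) ^ 2 * Real.sin_sq_add_cos_sq (p 1) + Real.sin_sq_add_cos_sq (p 0)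

/-- `σ_ρ(p)` lies on the sphere of radius `ρ ≥ 0`. [folklore] -/
theorem sphMap_mem_sphere {ρ : ℝ} (hρ : 0 ≤ ρ) (p : E2) : ρ • sphUnit p ∈ sphere (0 : E3) ρ := by
  rw [mem_sphere_zero_iff_norm, norm_smul, norm_sphUnit, mul_one, Real.norm_of_nonneg hρ]

/-! ### Injectivity on the box -/

/-- **`σ_ρ` is injective on `(0, π) × (−π, π)`** for `ρ ≠ 0`: `cos θ` determines `θ ∈ (0, π)`
(`injOn_cos`), and then `(cos φ, sin φ)` determines `φ ∈ (−π, π)` (Mathlib's `polarCoord`).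
[folklore] -/
theorem injOn_sphMap {ρ : ℝ} (hρ : ρ ≠ 0) : InjOn (fun q : E2 ↦ ρ • sphUnit q) sphBox := by
  intro p hp p' hp' h
  have hu : sphUnit p = sphUnit p' := smul_right_injective E3 hρ h
  have h0 : sin (p 0) * cos (p 1) = sin (p' 0) * cos (p' 1) := by
    simpa using congrArg (fun y : E3 ↦ y 0) hu
  have h1 : sin (p 0) * sin (p 1) = sin (p' 0) * sin (p' 1) := by
    simpa using congrArg (fun y : E3 ↦ y 1) hu
  have h2 : cos (p 0) = cos (p' 0) := by
    simpa using congrArg (fun y : E3 ↦ y 2) hu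
  have hθ : p 0 = p' 0 :=
    injOn_cos (Ioo_subset_Icc_self hp.1) (Ioo_subset_Icc_self hp'.1) h2
  have hsin : 0 < sin (p 0) := sin_pos_of_mem_Ioo hp.1
  rw [← hθ] at h0 h1
  have hc : cos (p 1) = cos (p' 1) := mul_left_cancel₀ hsin.ne' h0
  have hs : sin (p 1) = sin (p' 1) := mul_left_cancel₀ hsin.ne' h1
  have hφ : p 1 = p' 1 := by
    have hmem : ((1 : ℝ), p 1) ∈ polarCoord.target := by
      rw [polarCoord_target]
      exact Set.mk_mem_prod (Set.mem_Ioi.mpr one_pos) hp.2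
    have hmem' : ((1 : ℝ), p' 1) ∈ polarCoord.target := by
      rw [polarCoord_target]
      exact Set.mk_mem_prod (Set.mem_Ioi.mpr one_pos) hp'.2
    have heq : polarCoord.symm ((1 : ℝ), p 1) = polarCoord.symm ((1 : ℝ), p' 1) := by
      rw [polarCoord_symm_apply, polarCoord_symm_apply]
      simp [hc, hs]
    have := polarCoord.symm.injOn hmem hmem' heq
    simpa using congrArg Prod.snd this
  ext i
  fin_cases i
  · exact hθ
  · exact hφ

/-! ### The sphere minus a great circle is covered -/

/-- Squared coordinates of a point of the sphere of radius `ρ` sum to `ρ²`. [folklore] -/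
theorem sum_sq_of_mem_sphere {ρ : ℝ} {y : E3} (hy : y ∈ sphere (0 : E3) ρ) :
    y 0 ^ 2 + y 1 ^ 2 + y 2 ^ 2 = ρ ^ 2 := by
  rw [mem_sphere_zero_iff_norm] at hy
  have h := EuclideanSpace.norm_sq_eq y
  rw [hy, Fin.sum_univ_three] at h
  simp only [Real.norm_eq_abs, sq_abs] at h
  linarith

/-- **Every point of the sphere off the plane `{y₁ = 0}` is in the image of the box**:
`θ = arccos (y₂/ρ)`, `φ` the polar angle of `(y₀, y₁)` (Mathlib's `polarCoord`). [folklore] -/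
theorem exists_sphMap_eq {ρ : ℝ} (hρ : 0 < ρ) {y : E3} (hy : y ∈ sphere (0 : E3) ρ)
    (hy1 : y 1 ≠ 0) : ∃ p ∈ sphBox, ρ • sphUnit p = y := by
  have hsum := sum_sq_of_mem_sphere hy
  have hr2 : 0 < y 0 ^ 2 + y 1 ^ 2 := by positivity
  set t : ℝ := y 2 / ρ with ht
  have ht2 : t ^ 2 < 1 := by
    rw [ht, div_pow, div_lt_one (by positivity)]
    linarith
  have ht1 : -1 < t ∧ t < 1 := abs_lt.mp ((sq_lt_one_iff_abs_lt_one t).mp ht2)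
  -- the polar angle
  set θ : ℝ := arccos t with hθ
  have hθmem : θ ∈ Ioo 0 π := ⟨arccos_pos.mpr ht1.2, arccos_lt_pi.mpr ht1.1⟩
  have hcos : cos θ = t := cos_arccos ht1.1.le ht1.2.le
  have hsin : sin θ = √(y 0 ^ 2 + y 1 ^ 2) / ρ := by
    rw [hθ, sin_arccos, ht]
    have h1 : 1 - (y 2 / ρ) ^ 2 = (y 0 ^ 2 + y 1 ^ 2) / ρ ^ 2 := by
      field_simp
      linarith
    rw [h1, Real.sqrt_div' _ (by positivity), Real.sqrt_sq hρ.le]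
  -- the azimuth
  have hsrc : (y 0, y 1) ∈ polarCoord.source := by
    rw [polarCoord_source]
    exact Or.inr hy1
  set φ : ℝ := (polarCoord (y 0, y 1)).2 with hφ
  have htgt := polarCoord.map_source hsrc
  rw [polarCoord_target] at htgt
  have hφmem : φ ∈ Ioo (-π) π := htgt.2
  have hback := polarCoord.left_inv hsrc
  rw [polarCoord_symm_apply, Prod.ext_iff] at hback
  have hfst : (polarCoord (y 0, y 1)).1 = √(y 0 ^ 2 + y 1 ^ 2) := by
    rw [polarCoord_apply]
  rw [hfst] at hback
  obtain ⟨hb0, hb1⟩ := hback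
  dsimp only at hb0 hb1
  -- the parameter point
  refine ⟨WithLp.toLp 2 ![θ, φ], ⟨by simpa using hθmem, by simpa using hφmem⟩, ?_⟩
  have hρ0 : ρ ≠ 0 := hρ.ne'
  have c0 : ρ * (sin θ * cos φ) = y 0 := by
    rw [hsin, show ρ * (√(y 0 ^ 2 + y 1 ^ 2) / ρ * cos φ) = √(y 0 ^ 2 + y 1 ^ 2) * cos φ by
      field_simp]
    exact hb0
  have c1 : ρ * (sin θ * sin φ) = y 1 := by
    rw [hsin, show ρ * (√(y 0 ^ 2 + y 1 ^ 2) / ρ * sin φ) = √(y 0 ^ 2 + y 1 ^ 2) * sin φ by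
      field_simp]
    exact hb1
  have c2 : ρ * cos θ = y 2 := by
    rw [hcos, ht]
    field_simp
  ext i
  fin_cases i
  · simp only [PiLp.smul_apply, smul_eq_mul, Fin.zero_eta, Fin.isValue,
      Matrix.cons_val_zero, Matrix.cons_val_one, Matrix.cons_val_fin_one]
    linarith [c0]
  · simp only [PiLp.smul_apply, smul_eq_mul, Fin.mk_one, Fin.isValue,
      Matrix.cons_val_zero, Matrix.cons_val_one, Matrix.cons_val_fin_one]
    linarith [c1]
  · simp only [PiLp.smul_apply, smul_eq_mul, Fin.reduceFinMk, Fin.isValue,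
      Matrix.cons_val_zero, Matrix.cons_val_two, Matrix.tail_cons, Matrix.head_cons,
      Matrix.cons_val_one, Matrix.cons_val_fin_one]
    linarith [c2]

/-- The part of the sphere not covered by the box lies on the great circle `{y₁ = 0}`.
[folklore] -/
theorem sphere_diff_image_sphMap_subset {ρ : ℝ} (hρ : 0 < ρ) :
    sphere (0 : E3) ρ \ (fun q : E2 ↦ ρ • sphUnit q) '' sphBox ⊆
      {y : E3 | y 1 = 0} ∩ sphere (0 : E3) ρ := by
  rintro y ⟨hy, hni⟩
  refine ⟨?_, hy⟩
  by_contra h1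
  obtain ⟨p, hp, hpy⟩ := exists_sphMap_eq hρ hy h1
  exact hni ⟨p, hp, hpy⟩

/-- The image of the box lies on the sphere. [folklore] -/
theorem image_sphMap_subset_sphere {ρ : ℝ} (hρ : 0 ≤ ρ) :
    (fun q : E2 ↦ ρ • sphUnit q) '' sphBox ⊆ sphere (0 : E3) ρ := by
  rintro _ ⟨p, -, rfl⟩
  exact sphMap_mem_sphere hρ p

/-! ### A great circle is `μHE[2]`-null -/

/-- **A great circle of a round sphere in `E3` has `2`-dimensional Euclidean Hausdorff measure
zero**: it is the isometric image of a circle of the Euclidean plane, where `μHE[2]` is Lebesgue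
measure and spheres are null (`Measure.addHaar_sphere`). [folklore] -/
theorem euclideanHausdorffMeasure_plane_inter_sphere (ρ : ℝ) :
    (μHE[2] : Measure E3) ({y : E3 | y 1 = 0} ∩ sphere (0 : E3) ρ) = 0 := by
  set ι : E2 → E3 := fun q ↦ WithLp.toLp 2 ![q 0, 0, q 1] with hι
  have hiso : Isometry ι := by
    refine Isometry.of_dist_eq fun a b ↦ ?_
    rw [EuclideanSpace.dist_eq, EuclideanSpace.dist_eq, Fin.sum_univ_three, Fin.sum_univ_two]
    simp [hι]
  have hsub : {y : E3 | y 1 = 0} ∩ sphere (0 : E3) ρ ⊆ ι '' sphere (0 : E2) ρ := by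
    rintro y ⟨h1, hy⟩
    have h1' : y 1 = 0 := h1
    have hsum := sum_sq_of_mem_sphere hy
    refine ⟨WithLp.toLp 2 ![y 0, y 2], ?_, ?_⟩
    · rw [mem_sphere_zero_iff_norm, EuclideanSpace.norm_eq, Fin.sum_univ_two]
      rw [mem_sphere_zero_iff_norm] at hy
      have hρ : 0 ≤ ρ := by rw [← hy]; exact norm_nonneg _
      rw [← Real.sqrt_sq hρ]
      congr 1
      simp only [Matrix.cons_val_zero, Matrix.cons_val_one,
        Matrix.cons_val_fin_one, Real.norm_eq_abs, sq_abs]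
      rw [h1'] at hsum
      linarith
    · ext i
      fin_cases i <;> simp [hι, h1']
  have hnull : (μHE[2] : Measure E3) (ι '' sphere (0 : E2) ρ) = 0 := by
    rw [hiso.euclideanHausdorffMeasure_image, EuclideanSpace.euclideanHausdorffMeasure_eq_volume]
    exact Measure.addHaar_sphere volume 0 ρ
  exact measure_mono_null hsub hnull

/-- The image of the box is almost all of the sphere. [folklore] -/
theorem image_sphMap_ae_eq_sphere {ρ : ℝ} (hρ : 0 < ρ) :
    (fun q : E2 ↦ ρ • sphUnit q) '' sphBox =ᵐ[(μHE[2] : Measure E3)] sphere (0 : E3) ρ := by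
  refine ae_eq_set.mpr ⟨?_, ?_⟩
  · rw [Set.sdiff_eq_empty.mpr (image_sphMap_subset_sphere hρ.le), measure_empty]
  · exact measure_mono_null (sphere_diff_image_sphMap_subset hρ)
      (euclideanHausdorffMeasure_plane_inter_sphere ρ)

/-! ### The area formula on the sphere -/

/-- The box is open, hence measurable. [folklore] -/
theorem measurableSet_sphBox : MeasurableSet sphBox := by
  have h0 : Continuous fun p : E2 ↦ (p 0 : ℝ) := (EuclideanSpace.proj (𝕜 := ℝ) (0 : Fin 2)).continuous
  have h1 : Continuous fun p : E2 ↦ (p 1 : ℝ) := (EuclideanSpace.proj (𝕜 := ℝ) (1 : Fin 2)).continuous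
  exact ((isOpen_Ioo.preimage h0).inter (isOpen_Ioo.preimage h1)).measurableSet

/-- **Area formula on the round sphere, image form**: for `ρ > 0` and any `f : E3 → ℝ`,
`∫_{σ_ρ(box)} f dμHE[2] = ∫_{box} ρ² sin θ · f(σ_ρ(θ, φ)) d(θ, φ)`
(`Literature.Analysis.Calculus.integral_image_eq_integral_normDet_smul`, Federer 3.2.5, with
`normDet = ρ² sin θ`). [cite: Federer1969, 3.2.5] -/
theorem setIntegral_image_sphMap {ρ : ℝ} (hρ : 0 < ρ) (f : E3 → ℝ) :
    ∫ y in (fun q : E2 ↦ ρ • sphUnit q) '' sphBox, f y ∂(μHE[2] : Measure E3) =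
      ∫ p in sphBox, (ρ ^ 2 * sin (p 0)) * f (ρ • sphUnit p) := by
  have h := Literature.Analysis.Calculus.integral_image_eq_integral_normDet_smul
    (P := E2) (V := E3) (s := sphBox) (f := fun q : E2 ↦ ρ • sphUnit q)
    (f' := fun p : E2 ↦ ρ • sphJacCLM p) measurableSet_sphBox
    (fun p _ ↦ (hasFDerivAt_sphMap ρ p).hasFDerivWithinAt)
    (fun p hp ↦ injective_sphJac_smul hρ p (sin_pos_of_mem_Ioo hp.1)) (injOn_sphMap hρ.ne') f
  rw [finrank_euclideanSpace_fin] at h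
  rw [h]
  refine setIntegral_congr_fun measurableSet_sphBox fun p hp ↦ ?_
  simp only
  rw [normDet_sphMap hρ.le p (sin_pos_of_mem_Ioo hp.1).le, smul_eq_mul]

/-- **Area formula on the round sphere**: for `ρ > 0` and any `f : E3 → ℝ`,
`∮_{|y| = ρ} f dμHE[2] = ∫_{(0,π)×(−π,π)} ρ² sin θ · f(ρ (sin θ cos φ, sin θ sin φ, cos θ)) d(θ, φ)`
(the uncovered great circle being `μHE[2]`-null). [cite: Federer1969, 3.2.5] -/
theorem setIntegral_sphere_eq_setIntegral_sphBox {ρ : ℝ} (hρ : 0 < ρ) (f : E3 → ℝ) :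
    ∫ y in sphere (0 : E3) ρ, f y ∂(μHE[2] : Measure E3) =
      ∫ p in sphBox, (ρ ^ 2 * sin (p 0)) * f (ρ • sphUnit p) := by
  rw [← setIntegral_image_sphMap hρ f]
  exact (setIntegral_congr_set (image_sphMap_ae_eq_sphere hρ)).symm

end LLSphere

end Summit.FinalStateConjecture.FinalStateConjecture.Theorems

end
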